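import Mathlib.Analysis.Calculus.ContDiff.Deriv
import Mathlib.Analysis.Calculus.Deriv.ZPow
import Mathlib.Analysis.Calculus.Taylor
import Mathlib.Analysis.SpecialFunctions.Pow.Real
import Mathlib.Analysis.Complex.RealDeriv
import HarnessLib

/-!
# Amplitudes smooth in `1/r` at infinity

A small symbol calculus used in the proof programme for the named fact
`Literature.Geometry.Lorentzian.Kerr.Costa2019_realAxisModeStability` (R. Teixeira da Costa,
Commun. Math. Phys. 378 (2020) 705–781 = arXiv:1910.02854 [Costa2019], Thm. 4.1), in the
far-field integrations by parts of §3.2.3 (Lemmas 3.10, 3.12, 3.15 there): the class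
`Costa2019.IsInvSmooth r₁ d g` of functions `g(r) = r^d G(1/r)` on `(r₁, ∞)` with `G` smooth on
`[0, 1/r₁]` and `d ∈ ℤ`. It contains constants, integer powers, `1/(r − c)` (`|c| < r₁`),
`1/(r² + a²)` and anything given as `G(1/r)`; it is closed under sums, products, scalar multiples
and `d/dr` (degree drops by one, `IsInvSmooth.hasDerivAt`); members are continuous, bounded by
`C r^d` (`norm_le`) and admit finite expansions in pure powers `Σ_{j≤J} aⱼ r^{d−j}` with
`O(r^{d−J−1})` remainders (`expansion`, Taylor's theorem for `G` at `0`). In the application the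
coefficient functions of the radial ODE, the symmetrised amplitude factor
`(r−r₋)^η (r−r₊)^ξ r^{2iMω} = H(1/r)` (`Costa2019.amplitude_inversion`) and smooth cut-offs equal
to `1` near infinity are members, so that all `r`-derivatives of the far-field amplitude are
"pure powers plus integrable remainders", which is what the regularisation of Whiting's
transform on the real axis by repeated integration by parts requires. Everything is proved.

## References
* R. Teixeira da Costa, CMP 378 (2020) 705–781, arXiv:1910.02854, §3.2.3. [Costa2019]
-/

noncomputable section

open Set Filter Topology

namespace Literature.Geometry.Lorentzian.Kerr

namespace Costa2019

/-- **Functions smooth in `1/r` at infinity, of integer degree `d`.** `IsInvSmooth r₁ d g` means: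
there is `G` smooth on `[0, 1/r₁]` with `g(r) = r^d G(1/r)` for all `r > r₁` (a classical symbol
of integer order `d` at `r = ∞`, analytic-type in `1/r` up to smoothness). [folklore] -/
def IsInvSmooth (r₁ : ℝ) (d : ℤ) (g : ℝ → ℂ) : Prop :=
  ∃ G : ℝ → ℂ, ContDiffOn ℝ ((⊤ : ℕ∞) : WithTop ℕ∞) G (Icc 0 r₁⁻¹) ∧
    ∀ r, r₁ < r → g r = (r : ℂ) ^ d * G r⁻¹

namespace IsInvSmooth

variable {r₁ : ℝ} {d d' : ℤ} {g g₁ g₂ : ℝ → ℂ}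

/-- `1/r ∈ [0, 1/r₁]` for `r > r₁ > 0`. [folklore] -/
theorem inv_mem (hr₁ : 0 < r₁) {r : ℝ} (hr : r₁ < r) : r⁻¹ ∈ Icc (0 : ℝ) r₁⁻¹ :=
  ⟨inv_nonneg.2 (hr₁.trans hr).le, (inv_le_inv₀ (hr₁.trans hr) hr₁).2 hr.le⟩

/-- A function given directly as `G(1/r)` with `G` smooth on `[0, 1/r₁]`. [folklore] -/
theorem of_comp_inv {G : ℝ → ℂ} (hG : ContDiffOn ℝ ((⊤ : ℕ∞) : WithTop ℕ∞) G (Icc 0 r₁⁻¹)) :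
    IsInvSmooth r₁ 0 (fun r => G r⁻¹) :=
  ⟨G, hG, fun r _ => by simp⟩

/-- Constants. [folklore] -/
theorem const (r₁ : ℝ) (c : ℂ) : IsInvSmooth r₁ 0 (fun _ => c) :=
  ⟨fun _ => c, contDiffOn_const, fun r _ => by simp⟩

/-- Integer powers `r^n`. [folklore] -/
theorem zpow (r₁ : ℝ) (n : ℤ) : IsInvSmooth r₁ n (fun r => (r : ℂ) ^ n) :=
  ⟨fun _ => 1, contDiffOn_const, fun r _ => by simp⟩

/-- Raising the degree. [folklore] -/
theorem mono_degree (hr₁ : 0 < r₁) (h : IsInvSmooth r₁ d g) (hd : d ≤ d') :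
    IsInvSmooth r₁ d' g := by
  obtain ⟨G, hG, hg⟩ := h
  obtain ⟨k, hk⟩ := Int.eq_ofNat_of_zero_le (sub_nonneg.2 hd)
  refine ⟨fun u => (u : ℂ) ^ k * G u, ?_, fun r hr => ?_⟩
  · exact ((Complex.ofRealCLM.contDiff.comp_contDiffOn contDiffOn_id).pow k).mul hG
  · have hr0 : (r : ℂ) ≠ 0 := by exact_mod_cast (hr₁.trans hr).ne'
    show g r = (r : ℂ) ^ d' * (((r⁻¹ : ℝ) : ℂ) ^ k * G r⁻¹)
    have : (d' : ℤ) = d + k := by omega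
    rw [hg r hr, this, zpow_add₀ hr0, zpow_natCast]
    push_cast
    rw [inv_pow, mul_assoc, ← mul_assoc ((r : ℂ) ^ k), mul_inv_cancel₀ (pow_ne_zero k hr0),
      one_mul]

/-- Sums (same degree). [folklore] -/
theorem add (h₁ : IsInvSmooth r₁ d g₁) (h₂ : IsInvSmooth r₁ d g₂) :
    IsInvSmooth r₁ d (fun r => g₁ r + g₂ r) := by
  obtain ⟨G₁, hG₁, hg₁⟩ := h₁
  obtain ⟨G₂, hG₂, hg₂⟩ := h₂
  refine ⟨fun u => G₁ u + G₂ u, hG₁.add hG₂, fun r hr => ?_⟩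
  show g₁ r + g₂ r = (r : ℂ) ^ d * (G₁ r⁻¹ + G₂ r⁻¹)
  rw [hg₁ r hr, hg₂ r hr]; ring

/-- Products (degrees add). [folklore] -/
theorem mul (hr₁ : 0 < r₁) (h₁ : IsInvSmooth r₁ d g₁) (h₂ : IsInvSmooth r₁ d' g₂) :
    IsInvSmooth r₁ (d + d') (fun r => g₁ r * g₂ r) := by
  obtain ⟨G₁, hG₁, hg₁⟩ := h₁
  obtain ⟨G₂, hG₂, hg₂⟩ := h₂
  refine ⟨fun u => G₁ u * G₂ u, hG₁.mul hG₂, fun r hr => ?_⟩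
  have h0 : (r : ℂ) ≠ 0 := by exact_mod_cast (hr₁.trans hr).ne'
  show g₁ r * g₂ r = (r : ℂ) ^ (d + d') * (G₁ r⁻¹ * G₂ r⁻¹)
  rw [hg₁ r hr, hg₂ r hr, zpow_add₀ h0]
  ring

/-- Scalar multiples. [folklore] -/
theorem const_mul (h : IsInvSmooth r₁ d g) (c : ℂ) : IsInvSmooth r₁ d (fun r => c * g r) := by
  obtain ⟨G, hG, hg⟩ := h
  refine ⟨fun u => c * G u, contDiffOn_const.mul hG, fun r hr => ?_⟩
  show c * g r = (r : ℂ) ^ d * (c * G r⁻¹)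
  rw [hg r hr]; ring

/-- `1/(r − c)` for a real pole `|c| < r₁`. [folklore] -/
theorem inv_sub (hr₁ : 0 < r₁) {c : ℝ} (hc : |c| < r₁) :
    IsInvSmooth r₁ (-1) (fun r => ((r : ℂ) - c)⁻¹) := by
  have hden : ∀ u ∈ Icc (0 : ℝ) r₁⁻¹, (1 : ℝ) - c * u ≠ 0 := by
    intro u hu
    have h1 : c * u ≤ |c| * u := mul_le_mul_of_nonneg_right (le_abs_self c) hu.1
    have h2 : |c| * u ≤ |c| * r₁⁻¹ := mul_le_mul_of_nonneg_left hu.2 (abs_nonneg c)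
    have h3 : |c| * r₁⁻¹ < 1 := by rw [← div_eq_mul_inv, div_lt_one hr₁]; exact hc
    intro h; nlinarith
  refine ⟨fun u => (((1 - c * u : ℝ) : ℂ))⁻¹, ?_, fun r hr => ?_⟩
  · have hsm : ContDiffOn ℝ ((⊤ : ℕ∞) : WithTop ℕ∞) (fun u : ℝ => ((1 - c * u : ℝ) : ℂ))
        (Icc 0 r₁⁻¹) :=
      Complex.ofRealCLM.contDiff.comp_contDiffOn
        (contDiffOn_const.sub (contDiffOn_const.mul contDiffOn_id))
    exact hsm.inv fun u hu => by exact_mod_cast hden u hu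
  · have hr0 : (r : ℝ) ≠ 0 := (hr₁.trans hr).ne'
    have hrc : r - c ≠ 0 := by
      have : c < r := (le_abs_self c).trans_lt (hc.trans hr)
      linarith
    have h1 := hden r⁻¹ (inv_mem hr₁ hr)
    have hr0' : (r : ℂ) ≠ 0 := by exact_mod_cast hr0
    have e : ((r : ℂ) - c) = (r : ℂ) * ((1 - c * r⁻¹ : ℝ) : ℂ) := by
      push_cast; field_simp
    show ((r : ℂ) - c)⁻¹ = (r : ℂ) ^ (-1 : ℤ) * (((1 - c * r⁻¹ : ℝ) : ℂ))⁻¹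
    rw [e, mul_inv, zpow_neg, zpow_one]

/-- `1/(r² + a²)`. [folklore] -/
theorem inv_sq_add_sq (hr₁ : 0 < r₁) (a : ℝ) :
    IsInvSmooth r₁ (-2) (fun r => (((r ^ 2 + a ^ 2 : ℝ) : ℂ))⁻¹) := by
  refine ⟨fun u => (((1 + a ^ 2 * u ^ 2 : ℝ) : ℂ))⁻¹, ?_, fun r hr => ?_⟩
  · have hsm : ContDiffOn ℝ ((⊤ : ℕ∞) : WithTop ℕ∞) (fun u : ℝ => ((1 + a ^ 2 * u ^ 2 : ℝ) : ℂ))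
        (Icc 0 r₁⁻¹) :=
      Complex.ofRealCLM.contDiff.comp_contDiffOn
        (contDiffOn_const.add (contDiffOn_const.mul (contDiffOn_id.pow 2)))
    refine hsm.inv fun u _ => ?_
    have : (0 : ℝ) < 1 + a ^ 2 * u ^ 2 := by positivity
    exact_mod_cast this.ne'
  · have hr0 : (r : ℝ) ≠ 0 := (hr₁.trans hr).ne'
    have hr0' : (r : ℂ) ≠ 0 := by exact_mod_cast hr0
    have e : (((r ^ 2 + a ^ 2 : ℝ) : ℂ)) = (r : ℂ) ^ (2 : ℤ) * ((1 + a ^ 2 * r⁻¹ ^ 2 : ℝ) : ℂ) := by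
      rw [zpow_ofNat]; push_cast; field_simp
    show (((r ^ 2 + a ^ 2 : ℝ) : ℂ))⁻¹ = (r : ℂ) ^ (-2 : ℤ) * (((1 + a ^ 2 * r⁻¹ ^ 2 : ℝ) : ℂ))⁻¹
    rw [e, mul_inv, ← zpow_neg]

/-- Size: `‖g(r)‖ ≤ C r^d` on `(r₁, ∞)`. [folklore] -/
theorem norm_le (hr₁ : 0 < r₁) (h : IsInvSmooth r₁ d g) :
    ∃ C, ∀ r, r₁ < r → ‖g r‖ ≤ C * r ^ d := by
  obtain ⟨G, hG, hg⟩ := h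
  obtain ⟨C, hC⟩ := isCompact_Icc.exists_bound_of_continuousOn hG.continuousOn
  refine ⟨C, fun r hr => ?_⟩
  have hr0 : 0 < r := hr₁.trans hr
  rw [hg r hr, norm_mul, Complex.norm_zpow, Complex.norm_real, Real.norm_eq_abs, abs_of_pos hr0,
    mul_comm]
  exact mul_le_mul_of_nonneg_right (hC _ (inv_mem hr₁ hr)) (zpow_nonneg hr0.le _)

/-- Continuity on `(r₁, ∞)`. [folklore] -/
theorem continuousOn (hr₁ : 0 < r₁) (h : IsInvSmooth r₁ d g) : ContinuousOn g (Ioi r₁) := by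
  obtain ⟨G, hG, hg⟩ := h
  have h1 : ContinuousOn (fun r : ℝ => (r : ℂ) ^ d * G r⁻¹) (Ioi r₁) := by
    refine ContinuousOn.mul ?_ ?_
    · refine (Complex.continuous_ofReal.continuousOn.zpow₀ d fun r hr => ?_)
      exact Or.inl (by exact_mod_cast (hr₁.trans hr).ne')
    · refine hG.continuousOn.comp (continuousOn_inv₀.mono ?_) fun r hr => inv_mem hr₁ hr
      intro r hr; exact (hr₁.trans hr).ne'
  exact h1.congr fun r hr => hg r hr

/-- **Closure under `d/dr`**, with the derivative of degree `d − 1`: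
`(r^d G(1/r))' = r^{d−1} (d G(u) − u G'(u))|_{u=1/r}`. [folklore] -/
theorem hasDerivAt (hr₁ : 0 < r₁) (h : IsInvSmooth r₁ d g) :
    ∃ g' : ℝ → ℂ, IsInvSmooth r₁ (d - 1) g' ∧ ∀ r, r₁ < r → HasDerivAt g (g' r) r := by
  obtain ⟨G, hG, hg⟩ := h
  have hU : UniqueDiffOn ℝ (Icc (0 : ℝ) r₁⁻¹) := uniqueDiffOn_Icc (inv_pos.2 hr₁)
  set G' : ℝ → ℂ := derivWithin G (Icc 0 r₁⁻¹) with hG'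
  have hG'smooth : ContDiffOn ℝ ((⊤ : ℕ∞) : WithTop ℕ∞) G' (Icc 0 r₁⁻¹) :=
    hG.derivWithin hU (by simp)
  set Gt : ℝ → ℂ := fun u => (d : ℂ) * G u - (u : ℂ) * G' u with hGt
  refine ⟨fun r => (r : ℂ) ^ (d - 1) * Gt r⁻¹, ⟨Gt, ?_, fun r _ => rfl⟩, fun r hr => ?_⟩
  · exact (contDiffOn_const.mul hG).sub
      ((Complex.ofRealCLM.contDiff.comp_contDiffOn contDiffOn_id).mul hG'smooth)
  · have hr0 : 0 < r := hr₁.trans hr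
    have hrc : (r : ℂ) ≠ 0 := by exact_mod_cast hr0.ne'
    -- `G` is differentiable at the interior point `u = 1/r`
    have hu : r⁻¹ ∈ Ioo (0 : ℝ) r₁⁻¹ := ⟨inv_pos.2 hr0, (inv_lt_inv₀ hr0 hr₁).2 hr⟩
    have hGd : HasDerivAt G (G' r⁻¹) r⁻¹ := by
      have h1 : DifferentiableWithinAt ℝ G (Icc 0 r₁⁻¹) r⁻¹ :=
        (hG.differentiableOn (by simp)) _ (Ioo_subset_Icc_self hu)
      have h2 : HasDerivWithinAt G (G' r⁻¹) (Icc 0 r₁⁻¹) r⁻¹ := h1.hasDerivWithinAt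
      exact h2.hasDerivAt (Icc_mem_nhds hu.1 hu.2)
    -- chain rule
    have hinv : HasDerivAt (fun x : ℝ => x⁻¹) (-(r ^ 2)⁻¹) r := hasDerivAt_inv hr0.ne'
    have hcomp : HasDerivAt (fun x : ℝ => G x⁻¹) (-(r ^ 2)⁻¹ • G' r⁻¹) r :=
      hGd.scomp r hinv
    have hz : HasDerivAt (fun x : ℝ => (x : ℂ) ^ d) ((d : ℂ) * (r : ℂ) ^ (d - 1)) r := by
      have h1 := hasDerivAt_zpow d (r : ℂ) (Or.inl hrc)
      exact h1.comp_ofReal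
    have hprod := hz.mul hcomp
    have heq : (fun x : ℝ => (x : ℂ) ^ d * G x⁻¹) =ᶠ[𝓝 r] g := by
      filter_upwards [Ioi_mem_nhds hr] with x hx
      exact (hg x hx).symm
    have hzd : (r : ℂ) ^ d = (r : ℂ) ^ (d - 1) * (r : ℂ) := by
      rw [← zpow_add_one₀ hrc, sub_add_cancel]
    refine (hprod.congr_of_eventuallyEq heq.symm).congr_deriv ?_
    simp only [hGt, Complex.real_smul]
    push_cast
    rw [hzd]
    field_simp
    ring

/-- **Finite expansion in pure powers** with an `O(r^{d−J−1})` remainder. [folklore] -/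
theorem expansion (hr₁ : 0 < r₁) (h : IsInvSmooth r₁ d g) (J : ℕ) :
    ∃ (a : ℕ → ℂ) (C : ℝ), ∀ r, r₁ < r →
      ‖g r - ∑ j ∈ Finset.range (J + 1), a j * (r : ℂ) ^ (d - j)‖ ≤ C * r ^ (d - J - 1 : ℤ) := by
  obtain ⟨G, hG, hg⟩ := h
  -- Taylor expansion of `G` at `0`
  have hU : UniqueDiffOn ℝ (Icc (0 : ℝ) r₁⁻¹) := uniqueDiffOn_Icc (inv_pos.2 hr₁)
  have hGJ : ContDiffOn ℝ (J + 1) G (Icc 0 r₁⁻¹) := hG.of_le (by exact_mod_cast le_top)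
  have hcont : ContinuousOn (iteratedDerivWithin (J + 1) G (Icc 0 r₁⁻¹)) (Icc 0 r₁⁻¹) :=
    hGJ.continuousOn_iteratedDerivWithin (by exact_mod_cast le_rfl) hU
  obtain ⟨C₀, hC₀⟩ := isCompact_Icc.exists_bound_of_continuousOn hcont
  set a : ℕ → ℂ := fun j => (((Nat.factorial j : ℝ)⁻¹ : ℝ) : ℂ) *
    iteratedDerivWithin j G (Icc 0 r₁⁻¹) 0 with ha
  refine ⟨a, C₀ / Nat.factorial J, fun r hr => ?_⟩
  have hr0 : 0 < r := hr₁.trans hr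
  have hu := inv_mem hr₁ hr
  have htaylor := taylor_mean_remainder_bound (inv_pos.2 hr₁).le hGJ hu hC₀
  have heq : taylorWithinEval G J (Icc 0 r₁⁻¹) 0 r⁻¹ =
      ∑ j ∈ Finset.range (J + 1), a j * (r⁻¹ : ℂ) ^ j := by
    rw [taylor_within_apply]
    refine Finset.sum_congr rfl fun j _ => ?_
    rw [sub_zero, Complex.real_smul, ha]
    push_cast
    ring
  rw [heq] at htaylor
  -- multiply through by `r^d`
  have hrc : (r : ℂ) ≠ 0 := by exact_mod_cast hr0.ne'
  have hsum : ∑ j ∈ Finset.range (J + 1), a j * (r : ℂ) ^ (d - j) =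
      (r : ℂ) ^ d * ∑ j ∈ Finset.range (J + 1), a j * (r⁻¹ : ℂ) ^ j := by
    rw [Finset.mul_sum]
    refine Finset.sum_congr rfl fun j _ => ?_
    rw [zpow_sub₀ hrc, zpow_natCast, inv_pow]
    field_simp
  rw [hg r hr, hsum, ← mul_sub, norm_mul, Complex.norm_zpow, Complex.norm_real, Real.norm_eq_abs,
    abs_of_pos hr0]
  calc r ^ d * ‖G r⁻¹ - ∑ j ∈ Finset.range (J + 1), a j * (r⁻¹ : ℂ) ^ j‖ ≤
      r ^ d * (C₀ * (r⁻¹ - 0) ^ (J + 1) / Nat.factorial J) :=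
        mul_le_mul_of_nonneg_left htaylor (zpow_nonneg hr0.le _)
    _ = C₀ / Nat.factorial J * r ^ (d - J - 1 : ℤ) := by
        rw [sub_zero, show (d - J - 1 : ℤ) = d + (-(J + 1 : ℕ) : ℤ) by push_cast; ring,
          zpow_add₀ hr0.ne', zpow_neg, zpow_natCast, inv_pow]
        ring

end IsInvSmooth

end Costa2019

end Literature.Geometry.Lorentzian.Kerr

end
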